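import Summits.HubbardSuperconductivity.HubbardSuperconductivity.Theorems.BalabanIRBirComplexStableXYRFSRepresentation
import HarnessLib

/-!
# Crux `BirComplexStableXYR` (stmt-HubbardSuperconductivity-14845), line `fat-gaussian-defect-calculus`, chapter 2:
# stub B1 `stub_sectorClassFunction` — the sector terms are gauge-class functions

Registered stub (lead c7, wave 5; skeleton `Cruxes/BirComplexStableXYR/Lines/fat_gaussian_defect_calculus.lean`), helper
(`--supports`) for the crux `Summit.HubbardSuperconductivity.HubbardSuperconductivity.Theses.BalabanIR.BirComplexStableXYR`.

**Statement.** On the engine's torus `Λ L M = (ℤ/L)² × ℤ/M` with its space–time chart `F = TorusChart.piProdZMod 2 L M`,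
for a `2πℤ^Λ`-periodic and rotation-invariant observable `O` and a (U1) table `c`, the pinned sector integral
`∫_{φ 0 ∈ [0,2π)} O(φ) e^{−A(φ)} W_v(d₀φ − 2πa) dφ` (`W_v` the smoothed-box bond weight) takes the same value at the
integer `1`-cochains `a + d₀ n` and `a`: it is a function of the gauge class `a + d₀ℤ^Λ` only.

**Proof.** Both integrands are invariant under constant shifts `φ ↦ φ + t` (rotation invariance of `O`,
`cexp_neg_action_add_const` under (U1), `fsRep_d₀_add_const`), so the gauge reduction of the constant mode
(`TorusChart.setIntegral_inter_eval_zero_mem_eq_smul` with `S = univ`) turns both sides into `2π ∫_{ψ : Λ∖0 → ℝ} (·)(extZero ψ) dψ`.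
On the pinned fields the gauge transformation `n` acts as the translation by `m' = 2π(n − n 0)` (which vanishes at the
origin): `extZero ψ` is the global rotation by `−2π n 0` of the `2πn`-translate of `extZero ψ − m' = extZero (ψ − m')`, so
`O` and `e^{−A}` take the same values at `extZero ψ` and at `extZero (ψ − m')` (rotation invariance, periodicity), while
`d₀(extZero ψ) − 2π(a + d₀ n) = d₀(extZero (ψ − m')) − 2πa` identically.  Translation invariance of Lebesgue measure on
`ℝ^{Λ∖0}` (`integral_sub_right_eq_self`) concludes.  No definitions; sorry-free. [folklore: Fröhlich–Spencer, CMP 81 (1981) §3,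
gauge invariance of the vortex-sector decomposition]
-/

set_option linter.dupNamespace false -- `Summit.<S>.<S>.Theorems…` repeats the summit name (D-0017 layout)

noncomputable section

namespace Summit.HubbardSuperconductivity.HubbardSuperconductivity.Theorems.FSUnfolding

open scoped BigOperators
open MeasureTheory Literature.MathematicalPhysics.QuantumFieldTheory Literature.Probability.LatticeModels
open Summit.HubbardSuperconductivity.BirComplexStableXYNegative

variable {r : ℕ}

/-- **Gauge reduction of the constant mode on the pinned field space.**  For an integrand `f` on the fields of the
engine's torus that is invariant under constant shifts, `∫_{φ 0 ∈ [0,2π)} f = 2π · ∫_{ψ : Λ∖0 → ℝ} f (extZero ψ)`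
(`TorusChart.setIntegral_inter_eval_zero_mem_eq_smul` with `S = univ`). [folklore] -/
theorem sectorClass_setIntegral_pinned_eq (L M : ℕ) [NeZero L] [NeZero M] (f : (Λ L M → ℝ) → ℂ)
    (hf : ∀ (φ : Λ L M → ℝ) (t : ℝ), f (fun x => φ x + t) = f φ) :
    (∫ φ in {φ : Λ L M → ℝ | φ 0 ∈ Set.Ico 0 (2 * Real.pi)}, f φ) =
      ((2 * Real.pi : ℝ) : ℂ) * ∫ ψ : TorusChart.Punctured (Λ L M) → ℝ, f (TorusChart.extZero ψ) := by
  have h := TorusChart.setIntegral_inter_eval_zero_mem_eq_smul (Λ := Λ L M) (S := Set.univ)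
    MeasurableSet.univ (fun _ _ => by simp) f hf (Set.Ico 0 (2 * Real.pi))
  rw [Set.inter_univ] at h
  rw [h]
  have hvol : (volume (Set.Ico (0 : ℝ) (2 * Real.pi))).toReal = 2 * Real.pi := by
    rw [Real.volume_Ico, sub_zero, ENNReal.toReal_ofReal (by linarith [Real.pi_pos])]
  rw [hvol, Complex.real_smul]
  congr 1
  simp only [Set.mem_univ, Set.setOf_true, Measure.restrict_univ]

/-- **Stub B1 `stub_sectorClassFunction` (registered signature, verbatim): sector terms are gauge-class functions.**
For a `2πℤ^Λ`-periodic, rotation-invariant observable `O` and a (U1) table, the pinned sector integral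
`∫_{φ 0 ∈ [0,2π)} O e^{−A} W_v(d₀φ − 2πa)` depends on the integer `1`-cochain `a` only through its gauge class
`a + d₀ℤ^Λ` (gauge reduction of the constant mode, periodicity, translation invariance on the pinned fields).  This is
what allows the tree-gauge sum of `stub_fsRepresentation(Obs)` to be regrouped by sector labels. [folklore] -/
theorem stub_sectorClassFunction :
    ∀ (r : ℕ) (K : ℝ) (c : Table r), (∀ n ∈ c.support, ∑ w, n w = 0) → ∀ (L M : ℕ) [NeZero L] [NeZero M] (v : NNReal)
      (O : (Λ L M → ℝ) → ℂ), (∀ (φ : Λ L M → ℝ) (n : Λ L M → ℤ), O (fun x => φ x + 2 * Real.pi * (n x : ℝ)) = O φ) →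
      (∀ (φ : Λ L M → ℝ) (t : ℝ), O (fun x => φ x + t) = O φ) →
      ∀ (a : Λ L M → Fin 3 → ℤ) (n : Λ L M → ℤ),
        (∫ φ in {φ : Λ L M → ℝ | φ 0 ∈ Set.Ico 0 (2 * Real.pi)},
          O φ * Complex.exp (-(action K c L M φ)) *
            ∏ x : Λ L M, ∏ i : Fin 3, ((∫ t in Set.Icc (-Real.pi) Real.pi, ProbabilityTheory.gaussianPDFReal 0 v
              ((TorusChart.piProdZMod 2 L M).d₀ φ x i
                - 2 * Real.pi * ((a x i + (TorusChart.piProdZMod 2 L M).d₀ n x i : ℤ) : ℝ) - t) : ℝ) : ℂ)) =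
        ∫ φ in {φ : Λ L M → ℝ | φ 0 ∈ Set.Ico 0 (2 * Real.pi)},
          O φ * Complex.exp (-(action K c L M φ)) *
            ∏ x : Λ L M, ∏ i : Fin 3, ((∫ t in Set.Icc (-Real.pi) Real.pi, ProbabilityTheory.gaussianPDFReal 0 v
              ((TorusChart.piProdZMod 2 L M).d₀ φ x i - 2 * Real.pi * (a x i : ℝ) - t) : ℝ) : ℂ) := by
  intro r K c hU1 L M _ _ v O hOper hOrot a n
  set F := TorusChart.piProdZMod 2 L M
  -- the smoothed-box bond weight and the sector integrand with a real shift `β` of the gradient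
  set Wt : (Λ L M → Fin 3 → ℝ) → ℂ := fun η => ∏ x : Λ L M, ∏ i : Fin 3,
    ((∫ t in Set.Icc (-Real.pi) Real.pi, ProbabilityTheory.gaussianPDFReal 0 v (η x i - t) : ℝ) : ℂ)
  set G : (Λ L M → Fin 3 → ℝ) → (Λ L M → ℝ) → ℂ := fun β φ =>
    O φ * Complex.exp (-(action K c L M φ)) * Wt (fun x i => F.d₀ φ x i - β x i) with hG
  set βan : Λ L M → Fin 3 → ℝ := fun x i => 2 * Real.pi * ((a x i + F.d₀ n x i : ℤ) : ℝ) with hβan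
  set βa : Λ L M → Fin 3 → ℝ := fun x i => 2 * Real.pi * (a x i : ℝ) with hβa
  -- both integrands are invariant under constant shifts of the field
  have hGinv : ∀ (β : Λ L M → Fin 3 → ℝ) (φ : Λ L M → ℝ) (t : ℝ), G β (fun x => φ x + t) = G β φ := by
    intro β φ t
    simp only [hG, hOrot φ t, cexp_neg_action_add_const K c hU1 L M φ t, fsRep_d₀_add_const F φ t]
  -- Step 1: gauge reduction of the constant mode on both sides
  show (∫ φ in {φ : Λ L M → ℝ | φ 0 ∈ Set.Ico 0 (2 * Real.pi)}, G βan φ) =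
    ∫ φ in {φ : Λ L M → ℝ | φ 0 ∈ Set.Ico 0 (2 * Real.pi)}, G βa φ
  rw [sectorClass_setIntegral_pinned_eq L M (G βan) (hGinv βan),
    sectorClass_setIntegral_pinned_eq L M (G βa) (hGinv βa)]
  congr 1
  -- Step 2: on the pinned fields the gauge transformation `n` is the translation by `m' = 2π(n − n 0)`
  set m' : Λ L M → ℝ := fun x => 2 * Real.pi * (n x : ℝ) - 2 * Real.pi * (n 0 : ℝ) with hm'
  have hm'0 : m' 0 = 0 := by simp [hm']
  have hpt : ∀ ψ : TorusChart.Punctured (Λ L M) → ℝ,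
      G βan (TorusChart.extZero ψ) = G βa (TorusChart.extZero (fun y => ψ y - m' y)) := by
    intro ψ
    -- `extZero ψ` is the global rotation by `−2π n 0` of the `2πn`-translate of `extZero ψ − m'`
    have hψ : TorusChart.extZero ψ = fun x =>
        (TorusChart.extZero ψ x - m' x + 2 * Real.pi * (n x : ℝ)) + (-(2 * Real.pi * (n 0 : ℝ))) := by
      funext x
      simp only [hm']
      ring
    have hO : O (TorusChart.extZero ψ) = O (fun x => TorusChart.extZero ψ x - m' x) :=
      calc O (TorusChart.extZero ψ)
          = O (fun x => (TorusChart.extZero ψ x - m' x + 2 * Real.pi * (n x : ℝ)) + (-(2 * Real.pi * (n 0 : ℝ)))) :=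
            congrArg O hψ
        _ = O (fun x => TorusChart.extZero ψ x - m' x + 2 * Real.pi * (n x : ℝ)) := hOrot _ _
        _ = O (fun x => TorusChart.extZero ψ x - m' x) := hOper _ _
    have hA : Complex.exp (-(action K c L M (TorusChart.extZero ψ))) =
        Complex.exp (-(action K c L M (fun x => TorusChart.extZero ψ x - m' x))) :=
      calc Complex.exp (-(action K c L M (TorusChart.extZero ψ)))
          = Complex.exp (-(action K c L M (fun x =>
              (TorusChart.extZero ψ x - m' x + 2 * Real.pi * (n x : ℝ)) + (-(2 * Real.pi * (n 0 : ℝ)))))) :=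
            congrArg (fun θ => Complex.exp (-(action K c L M θ))) hψ
        _ = Complex.exp (-(action K c L M (fun x => TorusChart.extZero ψ x - m' x + 2 * Real.pi * (n x : ℝ)))) :=
            cexp_neg_action_add_const K c hU1 L M _ _
        _ = Complex.exp (-(action K c L M (fun x => TorusChart.extZero ψ x - m' x))) :=
            cexp_neg_action_add_two_pi_mul K c L M _ _
    have hW : (fun x i => F.d₀ (TorusChart.extZero ψ) x i - βan x i) =
        fun x i => F.d₀ (fun z => TorusChart.extZero ψ z - m' z) x i - βa x i := by
      funext x i
      simp only [hβan, hβa, hm', TorusChart.d₀_apply, Int.cast_add, Int.cast_sub]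
      ring
    rw [← fsRep_extZero_sub ψ m' hm'0]
    simp only [hG]
    rw [hO, hA, hW]
  -- Step 3: translation invariance of Lebesgue measure on the pinned fields
  have hH : (fun ψ : TorusChart.Punctured (Λ L M) → ℝ => G βan (TorusChart.extZero ψ)) =
      fun ψ => (fun χ : TorusChart.Punctured (Λ L M) → ℝ => G βa (TorusChart.extZero χ))
        (ψ - fun y : TorusChart.Punctured (Λ L M) => m' y) := by
    funext ψ
    rw [hpt ψ]
    simp only [Pi.sub_def]
  rw [hH, integral_sub_right_eq_self
    (fun χ : TorusChart.Punctured (Λ L M) → ℝ => G βa (TorusChart.extZero χ))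
    (fun y : TorusChart.Punctured (Λ L M) => m' y)]

end Summit.HubbardSuperconductivity.HubbardSuperconductivity.Theorems.FSUnfolding

end
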